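import Literature.IUT.HodgeTheaters.InitialThetaDataLocalArrowClaimsAssembly
import Literature.IUT.HodgeTheaters.ThetaGeometryClaimsNonVacuityConsumers
import HarnessLib

/-!
# [IUTchI] Definition 3.1 (e)/(f): the local-claims theorem FIRES — an initial Θ-datum at which the §1 claims hold
# for the `K`-datum AND for every local datum `D.peLoc k ι` (non-vacuity, proof-only)

S. Mochizuki, *Inter-universal Teichmüller theory I*, §1 p. 38, §3 Def. 3.1 (e)(f) pp. 62–63 (kurims manuscript, May
2020) [claim: Mochizuki2012, status: disputed] (D-0012 claim key, series status DISPUTED — an INSTANTIATION at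
abc-iut-L5-t8's DEGENERATE π₁-side model over abc-iut-L5-t7's GENUINE number-field side; instantiated ≠ endorsed).

PROOF-ONLY (theorems only; no definitions, no instances). KIT-RULE check for this seat's hypothesis
`hA : D.geom.pe.ArrowCoveringClaims` carried by the local transport files (`InitialThetaDataLocalArrowProofs`,
`…Claims`, `…ClaimsAssembly`): composing abc-iut-L5-t8's `ThetaGeometryClaimsModel.exists_initialThetaData_negCompat`
(p429095: an `InitialThetaData` over `(F, K := F(E[l]), F̄ := AlgebraicClosure F)` — `InitialThetaData.ofArith` with
`geom :=` the claims model — whose §1 datum SATISFIES abc-iut-L5-t1's typed claims) with `arrowCoveringClaims_peLoc`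
(p431102) gives **`exists_initialThetaData_arrowCoveringClaims_peLoc`**: there is an initial Θ-datum `D` with
`D.geom.pe.ArrowCoveringClaims` and, for EVERY `K`-field `k`, Galois `Ω ⊇ k` and `K`-embedding `ι : F̄ → Ω`,
`(D.peLoc k ι).ArrowCoveringClaims` — the local-claims theorem is not vacuous. Nothing of the series is asserted; no
side is taken on [IUTchIII] Cor. 3.12.
-/

noncomputable section

namespace Literature.IUT.HodgeTheaters

namespace ThetaGeometryClaimsModel

universe u

variable {F : Type u} [Field F] [NumberField F] (E : WeierstrassCurve F) [E.IsElliptic] (l : ℕ)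

/-- **The local-claims theorem fires.** For every arithmetic input `A` of abc-iut-L5-t7's `InitialThetaData.ofArith`
(the GENUINE number-field side of Def. 3.1 (a)(b)(c)) and bad-place predicates with their two printed clauses, there
is an initial Θ-datum `D` over `(F, K := F(E[l]), F̄)` (abc-iut-L5-t8's claims model on the π₁ side) such that the
printed §1 claims hold for the `K`-datum AND — by `arrowCoveringClaims_peLoc` — for the local datum `D.peLoc k ι` of
`C_v̲ := C_K ×_K K_v̲` for EVERY `K`-field `k`, Galois extension `Ω ⊇ k` and `K`-embedding `ι : F̄ → Ω`.
DEGENERATE π₁ side; instantiated ≠ endorsed. [claim: Mochizuki2012, status: disputed] -/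
theorem exists_initialThetaData_arrowCoveringClaims_peLoc (A : ArithInput E l) [NeZero l]
    (Pb : BadPlacePredicates (TorsionField E l))
    (hbad_type : ∀ w : Val (TorsionField E l),
      toVMod F (TorsionField E l) E w ∈ Val.non '' A.VbadMod → Pb.IsTypeOneZModLPM w)
    (hbad_cusp : ∀ w : Val (TorsionField E l),
      toVMod F (TorsionField E l) E w ∈ Val.non '' A.VbadMod → Pb.IsCanonicalGeneratorCusp w) :
    ∃ D : InitialThetaData F (TorsionField E l) (AlgebraicClosure F) E l Pb,
      D.geom.pe.ArrowCoveringClaims ∧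
      ∀ (Ω : Type u) [Field Ω] [Algebra (TorsionField E l) Ω] (k : Type u) [Field k]
        [Algebra (TorsionField E l) k] [Algebra k Ω] [IsScalarTower (TorsionField E l) k Ω] [IsGalois k Ω]
        (ι : AlgebraicClosure F →ₐ[TorsionField E l] Ω),
        (D.peLoc k ι).ArrowCoveringClaims := by
  obtain ⟨D, -, hA, -⟩ := exists_initialThetaData_negCompat E l A Pb hbad_type hbad_cusp
  exact ⟨D, hA, fun Ω _ _ k _ _ _ _ _ ι => D.arrowCoveringClaims_peLoc k ι hA⟩

end ThetaGeometryClaimsModel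

end Literature.IUT.HodgeTheaters

end
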